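import Summits.AtomisticToContinuum.HydrodynamicLimit.Theses.RelayRaceLocality
import Summits.AtomisticToContinuum.HydrodynamicLimit.Theorems.BoltzmannGreenKubo.Negative.Stationarity
import HarnessLib

/-!
# Stub `stub_gibbsInvariance` of the line `Sketch` (log-window-tagged-tail) for the crux
`RelayRaceLocality.GibbsLightCone` (stmt-AtomisticToContinuum-12501)

Registered stub of the lead prover's skeleton (`Cruxes/GibbsLightCone/Lines/Sketch.lean`): the
homogeneous Gibbs law `localGibbsLaw σ a 0 θ N Φ` (constant activity `a`, zero drift, constant
temperature `θ`) is invariant under every time-`s` map of every hard-sphere flow `Φ`: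
`(Φ.flow s)_# G_N = G_N`. This is the tree theorem
`BoltzmannGreenKuboOrthMomentum.map_flow_localGibbsLaw_const` (Liouville's theorem
`HardSphereFlow.measurePreserving` + conservation of `Σᵢ ‖vᵢ − u‖²` on the conull, invariant good
set) at drift `u = 0`; no hypothesis on `σ, a, θ` is needed.

References: GST 2013 Prop. 4.1.1; CIP 1994 §4.2; Spohn 1991 Part I §2.3.
-/

namespace Summit.AtomisticToContinuum.HydrodynamicLimit.Theorems.LogWindowTaggedTail

open Literature.MathematicalPhysics.KineticTheory Literature.Analysis.FluidPDE MeasureTheory Filter Set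

/-- GIBBS INVARIANCE (registered stub `stub_gibbsInvariance` of the line `Sketch` for the crux
`GibbsLightCone`, stmt-AtomisticToContinuum-12501): the homogeneous Gibbs law (constant activity `a`,
zero drift, constant temperature `θ`) is invariant under every time-`s` map of every hard-sphere flow,
`(localGibbsLaw σ a 0 θ N Φ).map (Φ.flow s) = localGibbsLaw σ a 0 θ N Φ`. Liouville measure preserved
and the canonical density is a conserved function on the good set
(`BoltzmannGreenKuboOrthMomentum.map_flow_localGibbsLaw_const` at `u = 0`). [folklore] -/
theorem stub_gibbsInvariance :
    ∀ (σ a θ : ℝ) (N : ℕ)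
      (Φ : HardSphereFlow (Torus.geometry (Fin 3)) (hsDiameter σ N) (N + 1)) (s : ℝ),
      (localGibbsLaw σ (fun _ => a) (fun _ => 0) (fun _ => θ) N Φ).map (Φ.flow s) =
        localGibbsLaw σ (fun _ => a) (fun _ => 0) (fun _ => θ) N Φ :=
  fun _ a θ _ Φ s => BoltzmannGreenKuboOrthMomentum.map_flow_localGibbsLaw_const a θ 0 Φ s

end Summit.AtomisticToContinuum.HydrodynamicLimit.Theorems.LogWindowTaggedTail
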